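import Literature.IUT.LogThetaLattice.RadialData
import Literature.IUT.LogThetaLattice.StripFrameWitness
import Mathlib.CategoryTheory.Category.ULift
import HarnessLib

/-!
# [IUTchIII] Cor 2.3 — NON-VACUITY of the coric-data interface `Coric` (NV-L6 wave, row «NV-L6/Coric»)

Mochizuki, *Inter-universal Teichmüller Theory III*, kurims manuscript (May 2020), Cor 2.3 p. 73:
"coric data `†ℭ = (†D^⊢, F^{⊢×μ}(†D^⊢))`". PROOF-ONLY companion (no `def`, no `instance`, no `structure`) of
`RadialData.lean` (abc-iut-L6-t3: `Coric (E : ThetaCoricData S)` = the one-field record `(a_ℭ) dv : S.Dv`).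
abc-iut-w5-d114's INHABITATION CENSUS v3 (§A) lists `Coric` and `Coric.Hom` with ZERO producers; this file
records, kernel-checked, that

* `Coric.nonempty_iff` — `Coric E` is inhabited EXACTLY when the frame has a `D^⊢`-prime-strip (`Nonempty S.Dv`);
  the datum `E` plays no role;
* `Coric.nonempty_of_radial` — the PRINTED producer: the radial algorithm `†ℜ ↦ †ℭ` of Cor 2.3
  (`radialAlgorithm E : Radial E ⥤ Coric E`, landed) applied to any radial datum (the census counts
  def-conclusions, not functor images — this is the genuine producer in the tree); hence
  `Coric.nonempty_of_nonempty_DHT`: one `D`-`Θ^{±ell}NF`-Hodge theater suffices;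
* `Coric.hom_nonempty` / `Coric.iso_nonempty_of_iso` — `Coric.Hom` is inhabited (identities; and along any
  `D^⊢`-isomorphism, via `fxmOfDv.mapIso`);
* `Coric.nonempty_degenerate` — at abc-iut-L6-t3's landed WITNESS frame (`Witness.twoFrame`, every prime-strip
  category the one-object groupoid on `ℤˣ`; DEGENERATE model) with its `Witness.twoCoric`;
* `Coric.nonempty_iff_of_dv_eq_asSmall` — at any frame with `S.Dv = AsSmall Y`, in particular the GENUINE
  assembled frame `StripFrame.ofKits` (abc-iut-L6-t3, from the [IUTchI] kits; `Dv = AsSmall M.DMono` by `rfl`):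
  for every `ThetaCoricData` over it, `Coric` is inhabited iff `Y` (abc-iut-L5-t4's `𝒟^⊢`-prime-strips
  `M.DMono`) has an object — stated generically so that no kit hypothesis (`hbij`, `hsurj`, …) is re-bound.

HONEST LABEL (L6-lead §F v1.18p (4)): `nonempty_degenerate` is a TOY witness; `nonempty_iff_of_dv_eq_asSmall` is a
criterion at the genuine frame (no `ThetaCoricData` over `ofKits` is landed yet — census row ThetaCoricData =
`Witness.twoCoric` only — so the genuine instance is conditional on such an `E` and on `Nonempty M.DMono`).
Nothing of [IUTchIII] is asserted; a witness is consistency evidence only. [claim: Mochizuki2012, status: disputed]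
-/

namespace Literature.IUT.LogThetaLattice

open CategoryTheory

universe u

namespace Coric

variable {S : StripFrame.{u}} (E : ThetaCoricData S)

/-- **IUTchIII:Cor2.3** (kurims p.73) `Coric E` is inhabited iff the frame has a `D^⊢`-prime-strip: the record is
`(a_ℭ) †D^⊢` alone ((b_ℭ) is computed from it). [claim: Mochizuki2012, status: disputed] -/
theorem nonempty_iff : Nonempty (Coric E) ↔ Nonempty S.Dv :=
  ⟨fun ⟨C⟩ => ⟨C.dv⟩, fun ⟨X⟩ => ⟨⟨X⟩⟩⟩

/-- **IUTchIII:Cor2.3** (kurims p.73) The PRINTED producer: the radial algorithm `†ℜ ↦ †ℭ` (landed functor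
`radialAlgorithm E`) turns any radial datum into a coric datum. [claim: Mochizuki2012, status: disputed] -/
theorem nonempty_of_radial (R : Radial E) : Nonempty (Coric E) :=
  ⟨(radialAlgorithm E).obj R⟩

/-- **IUTchIII:Cor2.3** (kurims p.73) One `D`-`Θ^{±ell}NF`-Hodge theater suffices (a radial datum is (a_ℜ) `†HT^D`).
[claim: Mochizuki2012, status: disputed] -/
theorem nonempty_of_nonempty_DHT [h : Nonempty S.DHT] : Nonempty (Coric E) :=
  nonempty_of_radial E ⟨Classical.choice h⟩

/-- **IUTchIII:Cor2.3** (kurims p.73) The essential image of the radial algorithm exhausts `Coric E` (Cor 2.3 (i),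
landed `radialAlgorithm_essSurj`): every coric datum is isomorphic to one produced from a radial datum.
[claim: Mochizuki2012, status: disputed] -/
theorem exists_iso_radialAlgorithm_obj [Nonempty S.DHT] (C : Coric E) :
    ∃ R : Radial E, Nonempty ((radialAlgorithm E).obj R ≅ C) :=
  haveI := radialAlgorithm_essSurj E
  ⟨(radialAlgorithm E).objPreimage C, ⟨(radialAlgorithm E).objObjPreimageIso C⟩⟩

/-- **IUTchIII:Cor2.3** (kurims p.73) `Coric.Hom` is inhabited: the identity morphism of coric data.
[claim: Mochizuki2012, status: disputed] -/
theorem hom_nonempty (C : Coric E) : Nonempty (Coric.Hom C C) := ⟨𝟙 C⟩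

/-- **IUTchIII:Cor2.3** (kurims p.73) Along any isomorphism of `D^⊢`-prime-strips there is a morphism of coric data
((b_{Morℭ}) := `F^{⊢×μ}(d)`, which induces (a_{Morℭ}) = `d` by `mapIso_fxmOfDv_dv`); in particular any two coric
data are isomorphic (`iso_nonempty_Dv`). [claim: Mochizuki2012, status: disputed] -/
theorem hom_nonempty_of_iso (C C' : Coric E) (d : C.dv ≅ C'.dv) : Nonempty (Coric.Hom C C') :=
  ⟨⟨d, E.fxmOfDv.mapIso d, E.mapIso_fxmOfDv_dv d⟩⟩

/-- **IUTchIII:Cor2.3** (kurims p.73) Any two coric data are connected by a morphism (all `D^⊢`-prime-strips are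
isomorphic, `ThetaCoricData.iso_nonempty_Dv`). [claim: Mochizuki2012, status: disputed] -/
theorem hom_nonempty' (C C' : Coric E) : Nonempty (Coric.Hom C C') :=
  hom_nonempty_of_iso E C C' (E.iso_nonempty_Dv _ _).some

/-- **IUTchIII:Cor2.3** (kurims p.73) DEGENERATE witness: at abc-iut-L6-t3's landed witness frame `Witness.twoFrame`
(every prime-strip category = the one-object groupoid on `ℤˣ`) with `Witness.twoCoric`, the coric-data interface is
inhabited — degenerate: one `D^⊢`-prime-strip, all structure functors identities. [claim: Mochizuki2012, status: disputed] -/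
theorem nonempty_degenerate : Nonempty (Coric Witness.twoCoric) := ⟨⟨Witness.pt⟩⟩

end Coric

/-! ### At frames whose `D^⊢`-prime-strips are a small model `AsSmall Y` (e.g. the GENUINE `StripFrame.ofKits`) -/

/-- **IUTchIII:Cor2.3** (kurims p.73) GENUINE-frame criterion, stated generically: if the frame's category of
`D^⊢`-prime-strips is (definitionally) the small model `AsSmall Y` of a category `Y` — as for abc-iut-L6-t3's
frame ASSEMBLED FROM THE [IUTchI] KITS, `(StripFrame.ofKits L hbij hsurj hR X).Dv = AsSmall M.DMono` by `rfl`
(abc-iut-L5-t4's `𝒟^⊢`-prime-strips) — then for EVERY `ThetaCoricData E` over it the coric-data interface is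
inhabited iff `Y` has an object. (Instantiate with `h := rfl` at `StripFrame.ofKits`; no kit hypothesis is
re-bound here.) [claim: Mochizuki2012, status: disputed] -/
theorem Coric.nonempty_iff_of_dv_eq_asSmall {Y : Type u} [Category.{u} Y] {S : StripFrame.{max 1 u}}
    (E : ThetaCoricData S) (h : S.Dv = AsSmall.{max 1 u} Y) : Nonempty (Coric E) ↔ Nonempty Y := by
  rw [Coric.nonempty_iff, h]
  exact ⟨fun ⟨x⟩ => ⟨ULift.down x⟩, fun ⟨x⟩ => ⟨ULift.up x⟩⟩

end Literature.IUT.LogThetaLattice
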